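import Literature.NumberTheory.Automorphic.LanglandsTunnellTwist
import Literature.NumberTheory.Automorphic.StrongArtinGL2WeightOneDictionary
import Literature.NumberTheory.Automorphic.StrongArtinGL2GaloisSideProofs
import HarnessLib

/-!
# Langlands–Tunnell (lang.S30) from its leaves with Deligne–Serre in place of Gelbart's Prop. 4.1
# (pure proofs: theorems only — no definition, no named fact, nothing restated)

The leaf assemblies of **lang.S30** in the tree — `langlands_tunnell_of_leaves'`
(`LanglandsTunnellTwist`: ten named facts), `exists_isNewform1_of_isPiOfArtinRep_of_dictionary`
(`StrongArtinGL2WeightOneDictionary`: Prop. 4.2 from its printed inputs) — all carry Gelbart's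
Prop. 4.1 at the finite places, the named fact `frobSatakeCompatibleAt_of_isPiOfArtinRep`
(`StrongArtinGL2`; Gelbart, *Three lectures …* (1997), p. 178), whose printed proof (Jacquet, LNM 278,
Cor. 19.16; Langlands, *Base change for GL(2)*, pp. 23–24) needs the local theory of `GL(2)` at
every place.  The companion `StrongArtinGL2GaloisSideProofs` showed that over `ℚ` this input can
be traded for Deligne–Serre's Thm. 4.1 (`exists_complexGaloisRep_of_weight_one`, already in the
cone of lang.S30) through *strong multiplicity one on the Galois side* (Gelbart 1997, p. 177;
proved in `GaloisRepresentations/ArtinRepGaloisSideSMOProofs`).  This file records the resulting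
leaf assemblies, all **proved**:

* `exists_isNewform1_of_isPiOfArtinRep_of_dictionary_of_deligneSerre` — Gelbart's Prop. 4.2
  (`exists_isNewform1_of_isPiOfArtinRep`) from: Deligne–Serre Thm. 4.1 (existence of `ρ_f`),
  Deligne–Serre Thm. 4.6 (a) (`artinConductorNat_eq_level`, the conductor clause), "`π(σ)` is of
  weight one for odd `σ`" (`harch`) and the weight-one dictionary `π ↦ f_π` (`hdesc`) — i.e.
  `exists_isNewform1_of_isPiOfArtinRep_of_dictionary` without `hAE`.
* `langlands_tunnell_of_leaves_of_deligneSerre` — `langlands_tunnell ρ` for every `ρ` from the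
  eight functorial leaves of `strongArtin_of_isSolvable_of_leaves'` (Artin reciprocity for
  characters, automorphic induction of characters, base change ×3, Gelbart–Jacquet, Jacquet–Shalika,
  cuspidality of Tunnell's cubic lifts), Prop. 4.2 and Deligne–Serre Thm. 4.1 — i.e.
  `langlands_tunnell_of_leaves'` without `hAE`.
* `langlands_tunnell_of_leaves_of_dictionary_of_deligneSerre` — the same with Prop. 4.2 opened up
  into its two printed inputs `harch`, `hdesc` (its conductor clause is not needed by lang.S30):
  the complete list of hypotheses on which `langlands_tunnell` rests along the functorial route is
  then the eight leaves, `harch`, `hdesc` and Deligne–Serre's Thm. 4.1 — neither Prop. 4.1 nor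
  Thm. 4.6 (a).
* `langlands_tunnell_hasEntireContinuation_of_leaves_of_deligneSerre` — the Artin-side corollary
  (`langlands_tunnell_hasEntireContinuation`: `L(s, ρ)` entire for odd solvable `ρ`; Tunnell 1981,
  p. 173) from the same inputs and the Deligne–Serre comparison `L(s, ρ) = L(s, f)`.

## References

* S. Gelbart, *Three lectures …* (1997): Thm. 1.3, Thm. 2.1, §2.6, §4.1 (p. 177), Prop. 4.1,
  Prop. 4.2, §7.1–7.2. [Gelbart1997]
* J. Tunnell, Bull. AMS 5 (1981), p. 173, Lemma and Theorem. [Tunnell1981]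
* P. Deligne, J.-P. Serre, Ann. Sci. ÉNS 7 (1974), Thm. 4.1, Thm. 4.6 (a). [DeligneSerreASENS1974]
-/

noncomputable section

open scoped MatrixGroups NumberField Polynomial ModularForm Classical
open NumberField IsDedekindDomain Field Polynomial
open CongruenceSubgroup Rat.HeightOneSpectrum

namespace Literature.NumberTheory.Automorphic

open EllipticCurves.ModularForms

/-- **Gelbart's Prop. 4.2 from its printed inputs, with Deligne–Serre in place of Prop. 4.1**:
`exists_isNewform1_of_isPiOfArtinRep` from Deligne–Serre's Thm. 4.1 (`hDS`, existence of a `ρ_f`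
attached to each weight-one newform), Thm. 4.6 (a) (`hDSa`, the conductor of a `ρ` attached to a
newform of level `N` is `N`), "`π(σ)` is of weight one for odd irreducible `σ`" (`harch`, Gelbart's
proof of Prop. 4.2) and the weight-one dictionary `π ↦ f_π` (`hdesc`, Prop. 2.5 and Corollary) —
`exists_isNewform1_of_isPiOfArtinRep_of_dictionary` with `hAE` removed
(`conductorFree_of_isOfWeightOne` and
`exists_isNewform1_of_isPiOfArtinRep_of_conductorFree_of_deligneSerre`).
[cite: Gelbart1997, Prop. 4.2 (proof), Prop. 2.5 and Corollary]
[cite: DeligneSerreASENS1974, Thm. 4.1 and Thm. 4.6 (a)] -/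
theorem exists_isNewform1_of_isPiOfArtinRep_of_dictionary_of_deligneSerre
    (hDS : ∀ {N : ℕ} [NeZero N], exists_complexGaloisRep_of_weight_one (N := N))
    (hDSa : ∀ {N : ℕ} [NeZero N] {f : CuspForm (Gamma1 N) 1}
      {ρ : GaloisRepresentations.FramedArtinRep ℚ 2},
        artinConductorNat_eq_level (f := f) (ρ := ρ))
    (harch : ∀ (hcpt : isCompact_glFiniteIntegralLevel 2 ℚ)
      (σ : GaloisRepresentations.FramedArtinRep ℚ 2) (π : CuspidalAutomorphicRepData 2 ℚ hcpt),
      σ.toGaloisRep.IsIrreducible → σ.IsOdd → IsPiOfArtinRep σ π.1 → π.1.IsOfWeightOne)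
    (hdesc : ∀ (hcpt : isCompact_glFiniteIntegralLevel 2 ℚ) (π : CuspidalAutomorphicRepData 2 ℚ hcpt),
      π.1.IsOfWeightOne →
        ∃ (N : ℕ) (_ : NeZero N) (f : CuspForm (Gamma1 N) 1), IsNewform1 f ∧
          ∀ v : HeightOneSpectrum (𝓞 ℚ), ¬ ((primesEquiv v : Nat.Primes) : ℕ) ∣ N →
            ∃ α : Multiset ℂ, π.1.HasSatakeParamAt v α ∧
              satakePolynomial α =
                (EllipticCurves.ModularForms.heckePolynomial f (primesEquiv v : Nat.Primes)).map
                  (algebraMap (coeffCharField f) ℂ)) :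
    exists_isNewform1_of_isPiOfArtinRep :=
  exists_isNewform1_of_isPiOfArtinRep_of_conductorFree_of_deligneSerre hDS hDSa
    (conductorFree_of_isOfWeightOne harch hdesc)

/-- **lang.S30 from the functorial leaves, Prop. 4.2 and Deligne–Serre** (no Prop. 4.1): for every
`ρ : Γ_ℚ → GL_2(ℂ)`, `langlands_tunnell ρ` follows from the eight named facts of
`strongArtin_of_isSolvable_of_leaves'` (`LanglandsTunnellTwist`) — Artin reciprocity for characters,
automorphic induction of characters in prime degree, Langlands' base change for `GL(2)` in three
forms, the Gelbart–Jacquet adjoint lift, Jacquet–Shalika rigidity, the cuspidality of Tunnell's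
cubic lifts — together with Gelbart's Prop. 4.2 (`exists_isNewform1_of_isPiOfArtinRep`) and
Deligne–Serre's Thm. 4.1 (`exists_complexGaloisRep_of_weight_one`), by
`langlands_tunnell_of_strongArtin_of_deligneSerre`.  Compare `langlands_tunnell_of_leaves'`
(same, with Prop. 4.1 instead of Deligne–Serre).
[cite: Tunnell1981, p. 173, Lemma and Theorem] [cite: Gelbart1997, Thm. 1.3, §2.6, Prop. 4.2,
§7.1–7.2] [cite: DeligneSerreASENS1974, Thm. 4.1] -/
theorem langlands_tunnell_of_leaves_of_deligneSerre
    (hR : GaloisRepresentations.artinReciprocity_character) (hAI : automorphicInduction_character)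
    (hdesc3 : exists_cuspidal_descent_det_cubic) (hGJ : GelbartJacquet_adjoint_lift)
    (hJS : JacquetShalika_eq_of_rsData_eq) (hdesc : cuspidal_descent_cyclic)
    (ha : ArthurClozel_fibres_quadratic) (hb : tunnell_cuspidal_cubic_lifts)
    (hW1 : exists_isNewform1_of_isPiOfArtinRep)
    (hDS : ∀ {N : ℕ} [NeZero N], exists_complexGaloisRep_of_weight_one (N := N))
    (ρ : GaloisRepresentations.FramedArtinRep ℚ 2) : langlands_tunnell ρ :=
  langlands_tunnell_of_strongArtin_of_deligneSerre
    (strongArtin_of_isSolvable_of_leaves' hR hAI hdesc3 hGJ hJS hdesc ha hb) hW1 hDS ρ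

/-- **lang.S30 from the functorial leaves, the two printed inputs of Prop. 4.2 and Deligne–Serre's
Thm. 4.1** — the complete list of hypotheses of `langlands_tunnell` along the functorial route,
with neither Prop. 4.1 nor Thm. 4.6 (a): the eight leaves of `strongArtin_of_isSolvable_of_leaves'`;
"`π(σ)` is of weight one for odd irreducible `σ`" (`harch`); the weight-one dictionary `π ↦ f_π`
(`hdesc`, conductor-free, Gelbart's Corollary of Prop. 2.5); and the existence of a `ρ_f` attached
to every weight-one newform (Deligne–Serre Thm. 4.1).  Proof:
`langlands_tunnell_of_conductorFree_of_deligneSerre` with `conductorFree_of_isOfWeightOne`.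
[cite: Tunnell1981, p. 173, Lemma and Theorem] [cite: Gelbart1997, Thm. 1.3, §2.6, Prop. 4.2
(proof), Prop. 2.5 and Corollary, §7.1–7.2] [cite: DeligneSerreASENS1974, Thm. 4.1] -/
theorem langlands_tunnell_of_leaves_of_dictionary_of_deligneSerre
    (hR : GaloisRepresentations.artinReciprocity_character) (hAI : automorphicInduction_character)
    (hdesc3 : exists_cuspidal_descent_det_cubic) (hGJ : GelbartJacquet_adjoint_lift)
    (hJS : JacquetShalika_eq_of_rsData_eq) (hdesc : cuspidal_descent_cyclic)
    (ha : ArthurClozel_fibres_quadratic) (hb : tunnell_cuspidal_cubic_lifts)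
    (harch : ∀ (hcpt : isCompact_glFiniteIntegralLevel 2 ℚ)
      (σ : GaloisRepresentations.FramedArtinRep ℚ 2) (π : CuspidalAutomorphicRepData 2 ℚ hcpt),
      σ.toGaloisRep.IsIrreducible → σ.IsOdd → IsPiOfArtinRep σ π.1 → π.1.IsOfWeightOne)
    (hdict : ∀ (hcpt : isCompact_glFiniteIntegralLevel 2 ℚ) (π : CuspidalAutomorphicRepData 2 ℚ hcpt),
      π.1.IsOfWeightOne →
        ∃ (N : ℕ) (_ : NeZero N) (f : CuspForm (Gamma1 N) 1), IsNewform1 f ∧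
          ∀ v : HeightOneSpectrum (𝓞 ℚ), ¬ ((primesEquiv v : Nat.Primes) : ℕ) ∣ N →
            ∃ α : Multiset ℂ, π.1.HasSatakeParamAt v α ∧
              satakePolynomial α =
                (EllipticCurves.ModularForms.heckePolynomial f (primesEquiv v : Nat.Primes)).map
                  (algebraMap (coeffCharField f) ℂ))
    (hDS : ∀ {N : ℕ} [NeZero N], exists_complexGaloisRep_of_weight_one (N := N))
    (ρ : GaloisRepresentations.FramedArtinRep ℚ 2) : langlands_tunnell ρ :=
  langlands_tunnell_of_conductorFree_of_deligneSerre
    (strongArtin_of_isSolvable_of_leaves' hR hAI hdesc3 hGJ hJS hdesc ha hb)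
    (conductorFree_of_isOfWeightOne harch hdict) hDS ρ

/-- **Artin's conjecture for odd solvable `ρ : Γ_ℚ → GL₂(ℂ)` from the functorial leaves, the
dictionary and Deligne–Serre** (the named fact `langlands_tunnell_hasEntireContinuation` of
`Automorphic/ArtinLFunctions`; Tunnell 1981, p. 173): the inputs of
`langlands_tunnell_of_leaves_of_dictionary_of_deligneSerre`, the Deligne–Serre comparison
`L(s, ρ) = L(s, f)` (`artinLFunction_eq_cuspFormLSeries`) and Hecke's theorem
(`langlands_tunnell_hasEntireContinuation_of_langlands_tunnell`).
[cite: Tunnell1981, p. 173 and Theorem] [cite: Gelbart1997, Thm. 1.3 and Prop. 4.2]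
[cite: DeligneSerreASENS1974, Thm. 4.1] -/
theorem langlands_tunnell_hasEntireContinuation_of_leaves_of_deligneSerre
    (hR : GaloisRepresentations.artinReciprocity_character) (hAI : automorphicInduction_character)
    (hdesc3 : exists_cuspidal_descent_det_cubic) (hGJ : GelbartJacquet_adjoint_lift)
    (hJS : JacquetShalika_eq_of_rsData_eq) (hdesc : cuspidal_descent_cyclic)
    (ha : ArthurClozel_fibres_quadratic) (hb : tunnell_cuspidal_cubic_lifts)
    (harch : ∀ (hcpt : isCompact_glFiniteIntegralLevel 2 ℚ)
      (σ : GaloisRepresentations.FramedArtinRep ℚ 2) (π : CuspidalAutomorphicRepData 2 ℚ hcpt),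
      σ.toGaloisRep.IsIrreducible → σ.IsOdd → IsPiOfArtinRep σ π.1 → π.1.IsOfWeightOne)
    (hdict : ∀ (hcpt : isCompact_glFiniteIntegralLevel 2 ℚ) (π : CuspidalAutomorphicRepData 2 ℚ hcpt),
      π.1.IsOfWeightOne →
        ∃ (N : ℕ) (_ : NeZero N) (f : CuspForm (Gamma1 N) 1), IsNewform1 f ∧
          ∀ v : HeightOneSpectrum (𝓞 ℚ), ¬ ((primesEquiv v : Nat.Primes) : ℕ) ∣ N →
            ∃ α : Multiset ℂ, π.1.HasSatakeParamAt v α ∧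
              satakePolynomial α =
                (EllipticCurves.ModularForms.heckePolynomial f (primesEquiv v : Nat.Primes)).map
                  (algebraMap (coeffCharField f) ℂ))
    (hDS : ∀ {N : ℕ} [NeZero N], exists_complexGaloisRep_of_weight_one (N := N))
    (hDSL : ∀ {N : ℕ} [NeZero N] {f : CuspForm (Gamma1 N) 1}
      {ρ : GaloisRepresentations.FramedArtinRep ℚ 2},
        artinLFunction_eq_cuspFormLSeries (f := f) (ρ := ρ)) :
    langlands_tunnell_hasEntireContinuation :=
  langlands_tunnell_hasEntireContinuation_of_langlands_tunnell
    (langlands_tunnell_of_leaves_of_dictionary_of_deligneSerre hR hAI hdesc3 hGJ hJS hdesc ha hb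
      harch hdict hDS) hDSL

end Literature.NumberTheory.Automorphic

end
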